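import Literature.Analysis.FluidPDE.ElgindiBlockCalculus
import Literature.Analysis.FluidPDE.ElgindiNonlocalBounds
import Literature.Analysis.FluidPDE.ElgindiWordCalculus
import HarnessLib

/-!
# Coercivity of `𝓛_Γ^T` on one word `D_θ^iD_z^jf` ([Elgindi2021] Proposition 6.13, the inductive
step; [ElgindiGhoulMasmoudi2021] Proposition 3.2, the inductive step)

Topic `Literature/Analysis/FluidPDE`. Support file (definitions with bodies, everything proved; no
named facts) on the proof path of the named fact
`Literature.Analysis.FluidPDE.Elgindi.ElgindiGhoulMasmoudi2021_stabilityCore`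
(`ElgindiStabilityDecomposition.lean`). T. M. Elgindi, Ann. of Math. 194 (2021) =
arXiv:1904.04795, §6.3 proof of Proposition 6.13:

> "`(D_θ𝓛_Γ^T(f), D_θf)_{𝓗^{k−1}} ≥ c_{k−1}|D_θf|²_{𝓗^{k−1}} − C̄_k|f|_{𝓗^{k−1}}|D_θf|_{𝓗^{k−1}}` …
> `D_z(𝓛_Γ^T(f)) = 𝓛_Γ^T(D_zf) + E₂`, where `|E₂|_{𝓗^{k−1}} ≤ C̄_k(|f|_{𝓗^{k−1}} + |D_θf|_{𝓗^{k−1}})`.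
> Observe that the derivative term comes from the commutator with the angular transport term and
> `D_z` and this is why we choose `c_{1,k}` first",

and Elgindi–Ghoul–Masmoudi 2021, arXiv:1910.14071, §3.1 proof of Proposition 3.2 ("then we will
show that `(D_θ^{k−(j+1)}D_y^{j+1}𝓛^T f, D_θ^{k−(j+1)}D_y^{j+1}fW) ≥ (1/100)|D_θ^{k−(j+1)}D_y^{j+1}fW|²
− C|f|²_{𝓗^{k−1}} − C|D_θ^{k−j}D_y^jfW|²`").

**The word estimate** (`wordCoercivity`): for every word `(i, j)` with `i + j ≥ 1` there are `Λ ≥ 1`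
and `C ≥ 0` such that for all `0 < α ≤ 1/200` and all test functions `f` (smooth, compactly supported
inside the open strip, `L₁₂(f)(0) = 0`), with `u = D_θ^iD_z^jf`,
`Z_u + Λ(X_u + A_u + Y_u) ≤ blockΛ α Λ (D_θ^iD_z^j𝓛_Γ^Tf) u + C·(LOW_{i+j}(f) + HEAVY_{i,j}(f))`,
where `Z = sqW_η∘D_z`, `X = sqW_η`, `A = sqW_1`, `Y = sqW_γ∘D_θ` (`bQ = Z + X + A + Y`), `LOW_n(f)` is
the sum of `bQ` over the words of `f` of total order `< n`, and `HEAVY_{i,j}(f) = (X + A + Y)(D_θ^{i+1}D_z^{j−1}f)`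
(`0` for `j = 0`): the lower-order words and the `θ`-heavier word of the same order — exactly the
two error terms of the displayed inductions.
-/

noncomputable section

open MeasureTheory Set Function Real Filter Finset
open _root_.Topology

namespace Literature.Analysis.FluidPDE

namespace Elgindi

/-! ### Block quantities, lower-order and heavier sums -/

/-- The four block quantities of a function: `bQ = sqW_η(D_zg) + sqW_η(g) + sqW_1(g) + sqW_γ(D_θg)`. [cite: Elgindi2021, §6.2 Definition 6.10 (p. 17 of arXiv:1904.04795)] -/
def bQ (α : ℝ) (g : ℝ → ℝ → ℝ) : ℝ :=
  sqW wEta (Dz g) + sqW wEta g + sqW (fun _ => 1) g + sqW (wGam α) (Dθ g)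

/-- The word `D_θ^iD_z^jf`. [cite: ElgindiGhoulMasmoudi2021, §3.1 proof of Proposition 3.2 (p. 10 of arXiv:1910.14071)] -/
def word (i j : ℕ) (f : ℝ → ℝ → ℝ) : ℝ → ℝ → ℝ :=
  Dθ^[i] (Dz^[j] f)

/-- The lower-order sum `LOW_n(f) = Σ_{i+j<n} bQ(D_θ^iD_z^jf)`. [cite: Elgindi2021, §6.3 proof of Proposition 6.13 (the term `|f|_{𝓗^{k−1}}`) (p. 18 of arXiv:1904.04795)] -/
def lowSum (α : ℝ) (n : ℕ) (f : ℝ → ℝ → ℝ) : ℝ :=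
  ∑ i ∈ range n, ∑ j ∈ range n, if i + j < n then bQ α (word i j f) else 0

/-- The `θ`-heavier word's quantities `HEAVY_{i,j}(f) = (X + A + Y)(D_θ^{i+1}D_z^{j−1}f)`, `0` if `j = 0`. [cite: Elgindi2021, §6.3 proof of Proposition 6.13 (the term `|D_θf|_{𝓗^{k−1}}`) (p. 18 of arXiv:1904.04795)] -/
def heavySum (α : ℝ) (i j : ℕ) (f : ℝ → ℝ → ℝ) : ℝ :=
  if j = 0 then 0 else
    sqW wEta (word (i + 1) (j - 1) f) + sqW (fun _ => 1) (word (i + 1) (j - 1) f) + sqW (wGam α) (Dθ (word (i + 1) (j - 1) f))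

/-- Unfolding `word`. [folklore] -/
theorem word_def (i j : ℕ) (f : ℝ → ℝ → ℝ) : word i j f = Dθ^[i] (Dz^[j] f) := rfl

/-- Unfolding `bQ`. [folklore] -/
theorem bQ_def (α : ℝ) (g : ℝ → ℝ → ℝ) :
    bQ α g = sqW wEta (Dz g) + sqW wEta g + sqW (fun _ => 1) g + sqW (wGam α) (Dθ g) := rfl

/-! ### Elementary inequalities -/

/-- **Young with square roots**: `a√Q√R ≤ εR + (a²/(4ε))Q`. [folklore] -/
theorem young_sqrt {a Q R ε : ℝ} (hQ : 0 ≤ Q) (hR : 0 ≤ R) (hε : 0 < ε) :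
    a * Real.sqrt Q * Real.sqrt R ≤ ε * R + a ^ 2 / (4 * ε) * Q := by
  have hq := Real.sq_sqrt hQ
  have hr := Real.sq_sqrt hR
  have h0Q := Real.sqrt_nonneg Q
  have h0R := Real.sqrt_nonneg R
  have key : 4 * ε * (a * Real.sqrt Q * Real.sqrt R) ≤ a ^ 2 * Q + 4 * ε ^ 2 * R := by
    nlinarith [sq_nonneg (a * Real.sqrt Q - 2 * ε * Real.sqrt R)]
  have h4 : 0 < 4 * ε := by positivity
  rw [← sub_nonneg] at key ⊢
  have e : ε * R + a ^ 2 / (4 * ε) * Q - a * Real.sqrt Q * Real.sqrt R =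
      (a ^ 2 * Q + 4 * ε ^ 2 * R - 4 * ε * (a * Real.sqrt Q * Real.sqrt R)) / (4 * ε) := by
    field_simp
    ring
  rw [e]
  exact div_nonneg key h4.le

/-- `√(P + Q) ≤ √P + √Q`. [folklore] -/
theorem sqrt_add_le' {P Q : ℝ} (hP : 0 ≤ P) (hQ : 0 ≤ Q) : Real.sqrt (P + Q) ≤ Real.sqrt P + Real.sqrt Q := by
  rw [Real.sqrt_le_left (by positivity)]
  nlinarith [Real.sq_sqrt hP, Real.sq_sqrt hQ, Real.sqrt_nonneg P, Real.sqrt_nonneg Q]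

/-- Monotonicity of `√` packaged with a constant: `Q ≤ c·T` gives `√Q ≤ √c·√T`. [folklore] -/
theorem sqrt_le_sqrt_mul {Q c T : ℝ} (hc : 0 ≤ c) (h : Q ≤ c * T) : Real.sqrt Q ≤ Real.sqrt c * Real.sqrt T := by
  rw [← Real.sqrt_mul hc]; exact Real.sqrt_le_sqrt h

/-! ### Words of a test function -/

section Words

variable {f : ℝ → ℝ → ℝ} (hf : ∀ n : ℕ, ContDiff ℝ n (uncurry f)) (hs : HasCompactSupport (uncurry f))
  (hsub : tsupport (uncurry f) ⊆ strip)

include hf hs hsub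

/-- Words of a test function are test functions. [folklore] -/
theorem word_test (i j n : ℕ) : ContDiff ℝ n (uncurry (word i j f)) ∧ HasCompactSupport (uncurry (word i j f)) ∧
    tsupport (uncurry (word i j f)) ⊆ strip :=
  ⟨contDiff_iterate_Dθ_Dz_of_forall hf i j n, hasCompactSupport_iterate_Dθ_Dz hs i j,
    (tsupport_iterate_Dθ_Dz_subset i j).trans hsub⟩

omit hs hsub in
/-- `D_z` of a word is the next word in `z`, on the strip. [folklore] -/
theorem Dz_word (i j : ℕ) : ∀ p ∈ strip, Dz (word i j f) p.1 p.2 = word i (j + 1) f p.1 p.2 := by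
  intro p hp
  have hg : ContDiffOn ℝ ((i + 2 : ℕ) : WithTop ℕ∞) (uncurry (Dz^[j] f)) strip :=
    (contDiff_iterate_Dz_of_contDiff (hf ((i + 2) + j))).contDiffOn
  rw [word_def, word_def, Dz_iterate_Dθ hg le_rfl p hp, ← Function.iterate_succ_apply' Dz j f]

end Words

/-- `D_θ` of a word is the next word in `θ` (everywhere). [folklore] -/
theorem Dθ_word (i j : ℕ) (f : ℝ → ℝ → ℝ) : Dθ (word i j f) = word (i + 1) j f := by
  rw [word_def, word_def, Function.iterate_succ_apply']

/-! ### The weighted squares of test functions -/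

/-- `sqW` only sees the strip. [folklore] -/
theorem sqW_congr {ρ : ℝ → ℝ} {g₁ g₂ : ℝ → ℝ → ℝ} (h : ∀ p ∈ strip, g₁ p.1 p.2 = g₂ p.1 p.2) : sqW ρ g₁ = sqW ρ g₂ := by
  rw [sqW_def, sqW_def]
  exact setIntegral_congr_fun measurableSet_strip fun p hp => by rw [h p hp]

/-- Integrability of `(gw)²ρ` for a test function `g` and an admissible weight. [folklore] -/
theorem integrableOn_sqW {ρ : ℝ → ℝ} (hρ : IsWeight ρ) {g : ℝ → ℝ → ℝ} (hgc : Continuous (uncurry g))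
    (hgs : HasCompactSupport (uncurry g)) (hgsub : tsupport (uncurry g) ⊆ strip) :
    IntegrableOn (fun p : ℝ × ℝ => (g p.1 p.2 * radialWeight p.1) ^ 2 * ρ p.2) strip := by
  have hc : ContinuousOn (fun p : ℝ × ℝ => g p.1 p.2 * radialWeight p.1 ^ 2 * ρ p.2) strip :=
    ((hgc.continuousOn).mul (continuousOn_radialWeight_strip.pow 2)).mul hρ.continuousOn_strip
  exact (integrableOn_continuousOn_mul_test hc hgc hgs hgsub).congr_fun (fun p _ => by ring) measurableSet_strip

/-- `sqW_η ≤ sqW_γ` (`sin^{−η} ≤ sin^{−γ}` on the quarter, `α ≥ 0`). [folklore] -/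
theorem sqW_wEta_le_wGam {α : ℝ} (hα : 0 ≤ α) {g : ℝ → ℝ → ℝ} (hgc : Continuous (uncurry g))
    (hgs : HasCompactSupport (uncurry g)) (hgsub : tsupport (uncurry g) ⊆ strip) : sqW wEta g ≤ sqW (wGam α) g := by
  rw [sqW_def, sqW_def]
  refine setIntegral_mono_on (integrableOn_sqW isWeight_wEta hgc hgs hgsub)
    (integrableOn_sqW (isWeight_wGam α) hgc hgs hgsub) measurableSet_strip fun p hp => ?_
  have hsθ : 0 < Real.sin (2 * p.2) := Real.sin_pos_of_pos_of_lt_pi (by linarith [hp.2.1]) (by linarith [hp.2.2])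
  have hρ : wEta p.2 ≤ wGam α p.2 :=
    Real.rpow_le_rpow_of_exponent_ge hsθ (Real.sin_le_one _) (by unfold eta gammaExp; linarith)
  exact mul_le_mul_of_nonneg_left hρ (sq_nonneg _)

/-- `sqW_1 ≤ sqW_η` (`1 ≤ sin^{−η}` on the quarter). [folklore] -/
theorem sqW_one_le_wEta {g : ℝ → ℝ → ℝ} (hgc : Continuous (uncurry g))
    (hgs : HasCompactSupport (uncurry g)) (hgsub : tsupport (uncurry g) ⊆ strip) : sqW (fun _ => 1) g ≤ sqW wEta g := by
  rw [sqW_def, sqW_def]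
  refine setIntegral_mono_on (integrableOn_sqW isWeight_one hgc hgs hgsub)
    (integrableOn_sqW isWeight_wEta hgc hgs hgsub) measurableSet_strip fun p hp => ?_
  have hsθ : 0 < Real.sin (2 * p.2) := Real.sin_pos_of_pos_of_lt_pi (by linarith [hp.2.1]) (by linarith [hp.2.2])
  have hρ : (1 : ℝ) ≤ wEta p.2 :=
    Real.one_le_rpow_of_pos_of_le_one_of_nonpos hsθ (Real.sin_le_one _) (by unfold eta; norm_num)
  exact mul_le_mul_of_nonneg_left hρ (sq_nonneg _)

/-- `bQ ≥ 0`. [folklore] -/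
theorem bQ_nonneg (α : ℝ) (g : ℝ → ℝ → ℝ) : 0 ≤ bQ α g := by
  rw [bQ_def]
  have h1 := sqW_nonneg isWeight_wEta (Dz g)
  have h2 := sqW_nonneg isWeight_wEta g
  have h3 := sqW_nonneg isWeight_one g
  have h4 := sqW_nonneg (isWeight_wGam α) (Dθ g)
  positivity

/-- `LOW ≥ 0`. [folklore] -/
theorem lowSum_nonneg (α : ℝ) (n : ℕ) (f : ℝ → ℝ → ℝ) : 0 ≤ lowSum α n f := by
  unfold lowSum
  refine Finset.sum_nonneg fun i _ => Finset.sum_nonneg fun j _ => ?_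
  split_ifs
  · exact bQ_nonneg _ _
  · exact le_rfl

/-- `HEAVY ≥ 0`. [folklore] -/
theorem heavySum_nonneg (α : ℝ) (i j : ℕ) (f : ℝ → ℝ → ℝ) : 0 ≤ heavySum α i j f := by
  unfold heavySum
  split_ifs
  · exact le_rfl
  · have h2 := sqW_nonneg isWeight_wEta (word (i + 1) (j - 1) f)
    have h3 := sqW_nonneg isWeight_one (word (i + 1) (j - 1) f)
    have h4 := sqW_nonneg (isWeight_wGam α) (Dθ (word (i + 1) (j - 1) f))
    positivity

/-- A single lower-order word is bounded by `LOW`. [folklore] -/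
theorem bQ_le_lowSum (α : ℝ) {n i j : ℕ} (h : i + j < n) (f : ℝ → ℝ → ℝ) : bQ α (word i j f) ≤ lowSum α n f := by
  unfold lowSum
  have hi : i ∈ range n := mem_range.2 (by omega)
  have hj : j ∈ range n := mem_range.2 (by omega)
  have h1 : bQ α (word i j f) ≤ ∑ j' ∈ range n, if i + j' < n then bQ α (word i j' f) else 0 := by
    have := Finset.single_le_sum (f := fun j' => if i + j' < n then bQ α (word i j' f) else 0)
      (fun j' _ => by
        show 0 ≤ (if i + j' < n then bQ α (word i j' f) else 0)
        split_ifs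
        · exact bQ_nonneg _ _
        · exact le_rfl) hj
    simpa [h] using this
  refine h1.trans ?_
  exact Finset.single_le_sum (f := fun i' => ∑ j' ∈ range n, if i' + j' < n then bQ α (word i' j' f) else 0)
    (fun i' _ => Finset.sum_nonneg fun j' _ => by
      show 0 ≤ (if i' + j' < n then bQ α (word i' j' f) else 0)
      split_ifs
      · exact bQ_nonneg _ _
      · exact le_rfl) hi

/-! ### Uniform bounds for the radial coefficients -/

/-- **`|D_z^l(a/(1+z))| ≤ K` for all `l ≤ L`, `z ≥ 0`.** [folklore] -/
theorem exists_abs_iterate_Dz₁_const_div_le (a : ℝ) (L : ℕ) : ∃ K, 0 ≤ K ∧ ∀ l ≤ L, ∀ z : ℝ, 0 ≤ z →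
    |Dz₁^[l] (fun z : ℝ => a / (1 + z)) z| ≤ K := by
  induction L with
  | zero =>
    refine ⟨|a|, abs_nonneg _, fun l hl z hz => ?_⟩
    rw [Nat.le_zero.1 hl, Function.iterate_zero_apply, abs_div, abs_of_pos (by positivity : (0 : ℝ) < 1 + z)]
    exact div_le_self (abs_nonneg _) (by linarith)
  | succ L ih =>
    obtain ⟨K₁, hK₁0, hK₁⟩ := ih
    obtain ⟨K₂, hK₂0, hK₂⟩ := exists_abs_iterate_Dz₁_one_div_one_add_le (L + 1)
    refine ⟨max K₁ (|a| * K₂), le_max_of_le_left hK₁0, fun l hl z hz => ?_⟩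
    rcases Nat.lt_or_ge l (L + 1) with h | h
    · exact (hK₁ l (by omega) z hz).trans (le_max_left _ _)
    · rw [le_antisymm hl h]
      have e : (fun z : ℝ => a / (1 + z)) = fun z => a * (fun z : ℝ => 1 / (1 + z)) z := by
        funext z; ring
      rw [e, iterate_Dz₁_const_mul]
      show |a * Dz₁^[L + 1] (fun z : ℝ => 1 / (1 + z)) z| ≤ _
      rw [abs_mul]
      have h1 := hK₂ z hz
      have h2 : K₂ * (1 / (1 + z)) ≤ K₂ := by
        have : 1 / (1 + z) ≤ 1 := by rw [div_le_one (by positivity)]; linarith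
        exact mul_le_of_le_one_right hK₂0 this
      exact (mul_le_mul_of_nonneg_left (h1.trans h2) (abs_nonneg _)).trans (le_max_right _ _)

/-- The radial coefficients `a/(1+z)` are smooth on `z > 0`. [folklore] -/
theorem contDiffOn_const_div_one_add (a : ℝ) (n : WithTop ℕ∞) : ContDiffOn ℝ n (fun z : ℝ => a / (1 + z)) (Ioi 0) :=
  contDiffOn_const.div (by fun_prop) fun z hz => by have : (0 : ℝ) < z := hz; positivity

/-! ### The abstract assembly step -/

/-- **Young bookkeeping for one word**: if the block dominates the strong local quantities up to cross
terms of the shape `a(√T + √X + √A + √Y)√Z + Λb√T(√X + √A + √Y)` and `Λ ≥ 1 + a² + b²`, then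
`Z + Λ(X + A + Y) ≤ P + (a² + Λb²)T`. [folklore] -/
theorem word_assembly {Λ a b Z X A Y T P : ℝ} (hZ : 0 ≤ Z) (hX : 0 ≤ X)
    (hA : 0 ≤ A) (hY : 0 ≤ Y) (hT : 0 ≤ T) (hΛ : 1 + a ^ 2 + b ^ 2 ≤ Λ)
    (hP : 39 / 10 * Z + Λ * (4 * 10 ^ 9 * X + 4 * 10 ^ 16 * A + 10 ^ 20 * Y)
      - (a * (Real.sqrt T + Real.sqrt X + Real.sqrt A + Real.sqrt Y) * Real.sqrt Z
        + Λ * b * Real.sqrt T * (Real.sqrt X + Real.sqrt A + Real.sqrt Y)) ≤ P) :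
    Z + Λ * (X + A + Y) ≤ P + (a ^ 2 + Λ * b ^ 2) * T := by
  have hΛ0 : 0 ≤ Λ := by nlinarith [sq_nonneg a, sq_nonneg b]
  have hε : (0 : ℝ) < 7 / 10 := by norm_num
  have y1 := young_sqrt (a := a) hT hZ hε
  have y2 := young_sqrt (a := a) hX hZ hε
  have y3 := young_sqrt (a := a) hA hZ hε
  have y4 := young_sqrt (a := a) hY hZ hε
  have y5 := young_sqrt (a := b) hT hX one_pos
  have y6 := young_sqrt (a := b) hT hA one_pos
  have y7 := young_sqrt (a := b) hT hY one_pos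
  -- the `Λ`-scaled Young inequalities
  have y5' := mul_le_mul_of_nonneg_left y5 hΛ0
  have y6' := mul_le_mul_of_nonneg_left y6 hΛ0
  have y7' := mul_le_mul_of_nonneg_left y7 hΛ0
  -- linear bookkeeping in the atoms
  have hcross : a * (Real.sqrt T + Real.sqrt X + Real.sqrt A + Real.sqrt Y) * Real.sqrt Z
        + Λ * b * Real.sqrt T * (Real.sqrt X + Real.sqrt A + Real.sqrt Y)
      ≤ 4 * (7 / 10) * Z + a ^ 2 / (4 * (7 / 10)) * (T + X + A + Y)
        + Λ * (X + A + Y) + Λ * (b ^ 2 / 4) * (3 * T) := by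
    have e1 : a * (Real.sqrt T + Real.sqrt X + Real.sqrt A + Real.sqrt Y) * Real.sqrt Z =
        a * Real.sqrt T * Real.sqrt Z + a * Real.sqrt X * Real.sqrt Z + a * Real.sqrt A * Real.sqrt Z +
          a * Real.sqrt Y * Real.sqrt Z := by ring
    have e2 : Λ * b * Real.sqrt T * (Real.sqrt X + Real.sqrt A + Real.sqrt Y) =
        Λ * (b * Real.sqrt T * Real.sqrt X) + Λ * (b * Real.sqrt T * Real.sqrt A) + Λ * (b * Real.sqrt T * Real.sqrt Y) := by
      ring
    rw [e1, e2]
    nlinarith [y1, y2, y3, y4, y5', y6', y7']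
  have hΛX : (1 + a ^ 2 + b ^ 2) * X ≤ Λ * X := mul_le_mul_of_nonneg_right hΛ hX
  have hΛA : (1 + a ^ 2 + b ^ 2) * A ≤ Λ * A := mul_le_mul_of_nonneg_right hΛ hA
  have hΛY : (1 + a ^ 2 + b ^ 2) * Y ≤ Λ * Y := mul_le_mul_of_nonneg_right hΛ hY
  have hΛT : 0 ≤ Λ * T := mul_nonneg hΛ0 hT
  have hΛb2T : 0 ≤ Λ * b ^ 2 * T := by positivity
  have ha2T : 0 ≤ a ^ 2 * T := by positivity
  have hb2X : 0 ≤ b ^ 2 * X := by positivity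
  have hb2A : 0 ≤ b ^ 2 * A := by positivity
  have hb2Y : 0 ≤ b ^ 2 * Y := by positivity
  have ha2X : 0 ≤ a ^ 2 * X := by positivity
  have ha2A : 0 ≤ a ^ 2 * A := by positivity
  have ha2Y : 0 ≤ a ^ 2 * Y := by positivity
  ring_nf at hP hcross hΛX hΛA hΛY hΛT hΛb2T ha2T hb2X hb2A hb2Y ha2X ha2A ha2Y ⊢
  linarith

/-! ### Splitting the block of a word along `𝓛_Γ^T = 𝓛₀ + [D^{ij}, 𝓛₀]-terms + non-local terms` -/

section Split

variable {α : ℝ} {f : ℝ → ℝ → ℝ} (hf : ∀ n : ℕ, ContDiff ℝ n (uncurry f)) (hs : HasCompactSupport (uncurry f))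
  (hsub : tsupport (uncurry f) ⊆ strip)

include hf hs hsub

/-- The commutator function of the word `(i, j)`:
`Σ_{l<j} C(j,l+1)·(D_z^{l+1}(2/(1+z))·D_θ^iD_z^{j−l−1}f + D_z^{l+1}(3/(1+z))·D_θ^{i+1}D_z^{j−l−1}f)`,
is `C¹` on the strip (indeed smooth). [folklore] -/
theorem contDiffOn_comPiece (i j l : ℕ) (a : ℝ) (i' : ℕ) :
    ContDiffOn ℝ 1 (uncurry (radialMul (Dz₁^[l + 1] (fun z : ℝ => a / (1 + z))) (word i' (j - (l + 1)) f))) strip := by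
  have _ := i
  refine contDiffOn_radialMul_Ioi ?_ ((word_test hf hs hsub i' (j - (l + 1)) 1).1.contDiffOn)
  exact contDiffOn_iterate_Dz₁_Ioi (N := l + 2) (contDiffOn_const_div_one_add a _) (by omega)

/-- The two separable non-local pieces are `C¹` on the strip. [folklore] -/
theorem contDiffOn_nlPiece (hα : 0 ≤ α) (i j : ℕ) :
    ContDiffOn ℝ 1 (uncurry (tensor (Dz₁^[j] (nlRad₁ α f)) (Dθ₁^[i] (angularWeight α)))) strip ∧
    ContDiffOn ℝ 1 (uncurry (tensor (Dz₁^[j] (nlRad₂ α f)) (Dθ₁^[i] (angularWeight α)))) strip := by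
  have _ := hα
  have hG : ContDiffOn ℝ 1 (Dθ₁^[i] (angularWeight α)) (Ioo 0 (π / 2)) :=
    contDiffOn_iterate_Dθ₁_Ioo (N := i + 1) (contDiffOn_angularWeight α _) le_rfl
  refine ⟨contDiffOn_tensor ?_ hG, contDiffOn_tensor ?_ hG⟩
  · exact contDiffOn_iterate_Dz₁_Ioi (N := j + 1) (contDiffOn_nlRad₁ α (hf (j + 1)) hs hsub) le_rfl
  · exact contDiffOn_iterate_Dz₁_Ioi (N := j + 1) (contDiffOn_nlRad₂ α f _) le_rfl

/-- **The block of a word, split**: for `α ≥ 0`, a test function `f` and the word `u = D_θ^iD_z^jf`,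
`blockΛ(D_θ^iD_z^j𝓛_Γ^Tf, u) = blockΛ(𝓛₀u, u) − Σ_{l<j} C(j,l+1)[blockΛ(D_z^{l+1}(2/(1+z))·D_θ^iD_z^{j−l−1}f, u)
+ blockΛ(D_z^{l+1}(3/(1+z))·D_θ^{i+1}D_z^{j−l−1}f, u)] + blockΛ((D_z^jS₁)⊗(D_θ^iΓ), u) +
blockΛ((D_z^jS₂)⊗(D_θ^iΓ), u)`. [cite: Elgindi2021, §6.3 proof of Proposition 6.13 (p. 18 of arXiv:1904.04795)] -/
theorem blockΛ_word_split (hα : 0 ≤ α) (Λ : ℝ) (i j : ℕ) :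
    blockΛ α Λ (Dθ^[i] (Dz^[j] (opLΓT α f))) (word i j f) =
      blockΛ α Λ (opLT0 (word i j f)) (word i j f)
      - ∑ l ∈ range j, (j.choose (l + 1) : ℝ) *
          (blockΛ α Λ (radialMul (Dz₁^[l + 1] (fun z : ℝ => 2 / (1 + z))) (word i (j - (l + 1)) f)) (word i j f)
            + blockΛ α Λ (radialMul (Dz₁^[l + 1] (fun z : ℝ => 3 / (1 + z))) (word (i + 1) (j - (l + 1)) f)) (word i j f))
      + blockΛ α Λ (tensor (Dz₁^[j] (nlRad₁ α f)) (Dθ₁^[i] (angularWeight α))) (word i j f)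
      + blockΛ α Λ (tensor (Dz₁^[j] (nlRad₂ α f)) (Dθ₁^[i] (angularWeight α))) (word i j f) := by
  obtain ⟨hu1, hus, husub⟩ := word_test hf hs hsub i j 1
  -- the pieces as functions
  set U : ℝ → ℝ → ℝ := opLT0 (word i j f) with hU
  set Cf : ℕ → ℝ → ℝ → ℝ := fun l => (j.choose (l + 1) : ℝ) •
    (radialMul (Dz₁^[l + 1] (fun z : ℝ => 2 / (1 + z))) (word i (j - (l + 1)) f)
      + radialMul (Dz₁^[l + 1] (fun z : ℝ => 3 / (1 + z))) (word (i + 1) (j - (l + 1)) f)) with hCf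
  set N₁ : ℝ → ℝ → ℝ := tensor (Dz₁^[j] (nlRad₁ α f)) (Dθ₁^[i] (angularWeight α)) with hN₁
  set N₂ : ℝ → ℝ → ℝ := tensor (Dz₁^[j] (nlRad₂ α f)) (Dθ₁^[i] (angularWeight α)) with hN₂
  -- regularity of the pieces on the strip
  have rU : ContDiffOn ℝ 1 (uncurry U) strip := contDiffOn_opLT0 ((word_test hf hs hsub i j 2).1.contDiffOn)
  have rC : ∀ l ∈ range j, ContDiffOn ℝ 1 (uncurry (Cf l)) strip := by
    intro l _
    have h := ((contDiffOn_comPiece hf hs hsub i j l 2 i).add (contDiffOn_comPiece hf hs hsub i j l 3 (i + 1))).const_smul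
      (j.choose (l + 1) : ℝ)
    exact h.congr fun p _ => by
      simp only [hCf, Function.uncurry, Pi.smul_apply, Pi.add_apply, smul_eq_mul]
  have rCs : ContDiffOn ℝ 1 (uncurry (∑ l ∈ range j, Cf l)) strip := contDiffOn_finset_sum _ rC
  obtain ⟨rN₁, rN₂⟩ := contDiffOn_nlPiece hf hs hsub hα i j
  -- the pointwise identity on the strip
  have hpt : ∀ p ∈ strip, Dθ^[i] (Dz^[j] (opLΓT α f)) p.1 p.2 = (U - ∑ l ∈ range j, Cf l + N₁ + N₂) p.1 p.2 := by
    intro p hp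
    have h1 := iterate_Dθ_Dz_opLΓT α (hf (i + j + 1)) hs hsub (i := i) (j := j) le_rfl p hp
    have h2 := iterate_Dθ_Dz_opLT0 (hf (i + j + 3)).contDiffOn (i := i) (j := j) le_rfl p hp
    rw [h1, h2]
    simp only [Pi.add_apply, Pi.sub_apply, Finset.sum_apply, hCf, Pi.smul_apply, smul_eq_mul, radialMul_apply,
      hU, hN₁, hN₂, tensor, word_def]
  have r1 : ContDiffOn ℝ 1 (uncurry (U - ∑ l ∈ range j, Cf l)) strip := (rU.sub rCs).congr fun p _ => rfl
  have r2 : ContDiffOn ℝ 1 (uncurry (U - ∑ l ∈ range j, Cf l + N₁)) strip := (r1.add rN₁).congr fun p _ => rfl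
  have hsum : ∑ k ∈ range j, blockΛ α Λ (Cf k) (word i j f) = ∑ l ∈ range j, (j.choose (l + 1) : ℝ) *
      (blockΛ α Λ (radialMul (Dz₁^[l + 1] (fun z : ℝ => 2 / (1 + z))) (word i (j - (l + 1)) f)) (word i j f)
        + blockΛ α Λ (radialMul (Dz₁^[l + 1] (fun z : ℝ => 3 / (1 + z))) (word (i + 1) (j - (l + 1)) f)) (word i j f)) := by
    refine Finset.sum_congr rfl fun l _ => ?_
    rw [hCf]
    show blockΛ α Λ ((j.choose (l + 1) : ℝ) • (radialMul (Dz₁^[l + 1] (fun z : ℝ => 2 / (1 + z))) (word i (j - (l + 1)) f)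
      + radialMul (Dz₁^[l + 1] (fun z : ℝ => 3 / (1 + z))) (word (i + 1) (j - (l + 1)) f))) (word i j f) = _
    rw [blockΛ_smul_left, blockΛ_add_left (contDiffOn_comPiece hf hs hsub i j l 2 i)
      (contDiffOn_comPiece hf hs hsub i j l 3 (i + 1)) hu1 hus husub]
  rw [blockΛ_congr_left hpt, blockΛ_add_left r2 rN₂ hu1 hus husub,
    blockΛ_add_left r1 rN₁ hu1 hus husub, blockΛ_sub_left rU rCs hu1 hus husub,
    blockΛ_sum_left _ rC hu1 hus husub, hsum]

end Split

/-! ### Components of `bQ`, `LOW`, `HEAVY` -/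

/-- `sqW_1(g) = ∬(gw)²`. [folklore] -/
theorem sqW_one_eq (g : ℝ → ℝ → ℝ) : sqW (fun _ => 1) g = ∫ p in strip, (g p.1 p.2 * radialWeight p.1) ^ 2 := by
  rw [sqW_def]; exact integral_congr_ae (Filter.Eventually.of_forall fun p => by simp)

/-- The four components are bounded by `bQ`. [folklore] -/
theorem components_le_bQ (α : ℝ) (g : ℝ → ℝ → ℝ) :
    sqW wEta (Dz g) ≤ bQ α g ∧ sqW wEta g ≤ bQ α g ∧ sqW (fun _ => 1) g ≤ bQ α g ∧ sqW (wGam α) (Dθ g) ≤ bQ α g := by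
  rw [bQ_def]
  have h1 := sqW_nonneg isWeight_wEta (Dz g)
  have h2 := sqW_nonneg isWeight_wEta g
  have h3 := sqW_nonneg isWeight_one g
  have h4 := sqW_nonneg (isWeight_wGam α) (Dθ g)
  exact ⟨by linarith, by linarith, by linarith, by linarith⟩

/-- The components of a lower-order word are bounded by `LOW + HEAVY`. [folklore] -/
theorem components_le_T {α : ℝ} {n i' j' : ℕ} (h : i' + j' < n) (i j : ℕ) (f : ℝ → ℝ → ℝ) :
    sqW wEta (Dz (word i' j' f)) ≤ lowSum α n f + heavySum α i j f ∧
    sqW wEta (word i' j' f) ≤ lowSum α n f + heavySum α i j f ∧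
    sqW (fun _ => 1) (word i' j' f) ≤ lowSum α n f + heavySum α i j f ∧
    sqW (wGam α) (Dθ (word i' j' f)) ≤ lowSum α n f + heavySum α i j f := by
  have hb := bQ_le_lowSum α h f
  have hh := heavySum_nonneg α i j f
  obtain ⟨c1, c2, c3, c4⟩ := components_le_bQ α (word i' j' f)
  exact ⟨by linarith, by linarith, by linarith, by linarith⟩

/-- The components of the heavier word are bounded by `LOW + HEAVY` (`j ≥ 1`). [folklore] -/
theorem heavy_components_le_T (α : ℝ) (i j : ℕ) (hj : j ≠ 0) (f : ℝ → ℝ → ℝ) :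
    sqW wEta (word (i + 1) (j - 1) f) ≤ lowSum α (i + j) f + heavySum α i j f ∧
    sqW (fun _ => 1) (word (i + 1) (j - 1) f) ≤ lowSum α (i + j) f + heavySum α i j f ∧
    sqW (wGam α) (Dθ (word (i + 1) (j - 1) f)) ≤ lowSum α (i + j) f + heavySum α i j f := by
  have hl := lowSum_nonneg α (i + j) f
  have h2 := sqW_nonneg isWeight_wEta (word (i + 1) (j - 1) f)
  have h3 := sqW_nonneg isWeight_one (word (i + 1) (j - 1) f)
  have h4 := sqW_nonneg (isWeight_wGam α) (Dθ (word (i + 1) (j - 1) f))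
  unfold heavySum
  rw [if_neg hj]
  exact ⟨by linarith, by linarith, by linarith⟩

/-! ### Monotone replacements inside the two piece bounds -/

/-- Monotone replacement in the radial-multiplier piece bound. [folklore] -/
theorem bound_mono_radial {P K Λ z x w y q1 q2 q3 q4 q5 t1 t2 t3 t4 t5 : ℝ} (hK : 0 ≤ K) (hΛ : 0 ≤ Λ)
    (hz : 0 ≤ z) (hx : 0 ≤ x) (hw : 0 ≤ w) (hy : 0 ≤ y)
    (h1 : q1 ≤ t1) (h2 : q2 ≤ t2) (h3 : q3 ≤ t3) (h4 : q4 ≤ t4) (h5 : q5 ≤ t5)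
    (h : P ≤ 10 * (K * q1 + K * q2) * z + Λ * (10 ^ 10 * K * q3 * x + 10 ^ 17 * K * q4 * w + 10 ^ 21 * K * q5 * y)) :
    P ≤ 10 * (K * t1 + K * t2) * z + Λ * (10 ^ 10 * K * t3 * x + 10 ^ 17 * K * t4 * w + 10 ^ 21 * K * t5 * y) := by
  refine h.trans ?_
  have a1 : K * q1 ≤ K * t1 := mul_le_mul_of_nonneg_left h1 hK
  have a2 : K * q2 ≤ K * t2 := mul_le_mul_of_nonneg_left h2 hK
  have a3 : 10 ^ 10 * K * q3 * x ≤ 10 ^ 10 * K * t3 * x :=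
    mul_le_mul_of_nonneg_right (mul_le_mul_of_nonneg_left h3 (by positivity)) hx
  have a4 : 10 ^ 17 * K * q4 * w ≤ 10 ^ 17 * K * t4 * w :=
    mul_le_mul_of_nonneg_right (mul_le_mul_of_nonneg_left h4 (by positivity)) hw
  have a5 : 10 ^ 21 * K * q5 * y ≤ 10 ^ 21 * K * t5 * y :=
    mul_le_mul_of_nonneg_right (mul_le_mul_of_nonneg_left h5 (by positivity)) hy
  have az : 10 * (K * q1 + K * q2) * z ≤ 10 * (K * t1 + K * t2) * z :=
    mul_le_mul_of_nonneg_right (by linarith) hz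
  have aΛ := mul_le_mul_of_nonneg_left (add_le_add (add_le_add a3 a4) a5) hΛ
  linarith

/-- `√(IJ) ≤ √(cd)·√T` from `I ≤ cT`, `J ≤ d`. [folklore] -/
theorem sqrt_prod_le {I J c d T : ℝ} (hI : I ≤ c * T) (hJ : J ≤ d) (hJ0 : 0 ≤ J) (hc : 0 ≤ c) (hT : 0 ≤ T) (hd : 0 ≤ d) :
    Real.sqrt (I * J) ≤ Real.sqrt (c * d) * Real.sqrt T := by
  have h1 : I * J ≤ c * T * d := mul_le_mul hI hJ hJ0 (by positivity)
  calc Real.sqrt (I * J) ≤ Real.sqrt (c * T * d) := Real.sqrt_le_sqrt h1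
    _ = Real.sqrt (c * d * T) := by ring_nf
    _ = Real.sqrt (c * d) * Real.sqrt T := Real.sqrt_mul (by positivity) T

/-- Monotone replacement in the separable piece bound. [folklore] -/
theorem bound_mono_tensor {P Λ z x w y s1 s2 s3 s4 t1 t2 t3 t4 : ℝ} (hΛ : 0 ≤ Λ)
    (hz : 0 ≤ z) (hx : 0 ≤ x) (hw : 0 ≤ w) (hy : 0 ≤ y)
    (h1 : s1 ≤ t1) (h2 : s2 ≤ t2) (h3 : s3 ≤ t3) (h4 : s4 ≤ t4)
    (h : P ≤ 10 * s1 * z + Λ * (10 ^ 10 * s2 * x + 10 ^ 17 * s3 * w + 10 ^ 21 * s4 * y)) :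
    P ≤ 10 * t1 * z + Λ * (10 ^ 10 * t2 * x + 10 ^ 17 * t3 * w + 10 ^ 21 * t4 * y) := by
  refine h.trans ?_
  have a1 : 10 * s1 * z ≤ 10 * t1 * z := mul_le_mul_of_nonneg_right (by linarith) hz
  have a2 : 10 ^ 10 * s2 * x ≤ 10 ^ 10 * t2 * x := mul_le_mul_of_nonneg_right (by linarith) hx
  have a3 : 10 ^ 17 * s3 * w ≤ 10 ^ 17 * t3 * w := mul_le_mul_of_nonneg_right (by linarith) hw
  have a4 : 10 ^ 21 * s4 * y ≤ 10 ^ 21 * t4 * y := mul_le_mul_of_nonneg_right (by linarith) hy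
  have aΛ := mul_le_mul_of_nonneg_left (add_le_add (add_le_add a2 a3) a4) hΛ
  linarith

/-- **The assembly step with grouped coefficients**: cross terms of the shape
`(a_T√T + a_Y√Y)√Z + Λ√T(b_X√X + b_A√A + b_Y√Y)` with `a_T, a_Y ≤ a`, `b_X, b_A, b_Y ≤ b`,
`Λ = 1 + a² + b²`. [folklore] -/
theorem word_assembly' {Λ a b aT aY bX bA bY Z X A Y T P : ℝ} (ha : 0 ≤ a) (hZ : 0 ≤ Z) (hX : 0 ≤ X)
    (hA : 0 ≤ A) (hY : 0 ≤ Y) (hT : 0 ≤ T) (haT : aT ≤ a) (haY : aY ≤ a) (hbX : bX ≤ b) (hbA : bA ≤ b) (hbY : bY ≤ b)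
    (hΛ : Λ = 1 + a ^ 2 + b ^ 2)
    (hP : 39 / 10 * Z + Λ * (4 * 10 ^ 9 * X + 4 * 10 ^ 16 * A + 10 ^ 20 * Y)
      - ((aT * Real.sqrt T + aY * Real.sqrt Y) * Real.sqrt Z
        + Λ * Real.sqrt T * (bX * Real.sqrt X + bA * Real.sqrt A + bY * Real.sqrt Y)) ≤ P) :
    Z + Λ * (X + A + Y) ≤ P + (a ^ 2 + Λ * b ^ 2) * T := by
  have hΛ0 : 0 ≤ Λ := by rw [hΛ]; positivity
  have sT := Real.sqrt_nonneg T
  have sX := Real.sqrt_nonneg X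
  have sA := Real.sqrt_nonneg A
  have sY := Real.sqrt_nonneg Y
  have sZ := Real.sqrt_nonneg Z
  have h1 : (aT * Real.sqrt T + aY * Real.sqrt Y) * Real.sqrt Z ≤
      a * (Real.sqrt T + Real.sqrt X + Real.sqrt A + Real.sqrt Y) * Real.sqrt Z := by
    refine mul_le_mul_of_nonneg_right ?_ sZ
    have e1 : aT * Real.sqrt T ≤ a * Real.sqrt T := mul_le_mul_of_nonneg_right haT sT
    have e2 : aY * Real.sqrt Y ≤ a * Real.sqrt Y := mul_le_mul_of_nonneg_right haY sY
    nlinarith [mul_nonneg ha sX, mul_nonneg ha sA]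
  have h2 : Λ * Real.sqrt T * (bX * Real.sqrt X + bA * Real.sqrt A + bY * Real.sqrt Y) ≤
      Λ * b * Real.sqrt T * (Real.sqrt X + Real.sqrt A + Real.sqrt Y) := by
    have e1 : bX * Real.sqrt X ≤ b * Real.sqrt X := mul_le_mul_of_nonneg_right hbX sX
    have e2 : bA * Real.sqrt A ≤ b * Real.sqrt A := mul_le_mul_of_nonneg_right hbA sA
    have e3 : bY * Real.sqrt Y ≤ b * Real.sqrt Y := mul_le_mul_of_nonneg_right hbY sY
    have e : bX * Real.sqrt X + bA * Real.sqrt A + bY * Real.sqrt Y ≤ b * (Real.sqrt X + Real.sqrt A + Real.sqrt Y) := by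
      linarith
    have := mul_le_mul_of_nonneg_left e (mul_nonneg hΛ0 sT)
    calc Λ * Real.sqrt T * (bX * Real.sqrt X + bA * Real.sqrt A + bY * Real.sqrt Y)
        ≤ Λ * Real.sqrt T * (b * (Real.sqrt X + Real.sqrt A + Real.sqrt Y)) := this
      _ = Λ * b * Real.sqrt T * (Real.sqrt X + Real.sqrt A + Real.sqrt Y) := by ring
  refine word_assembly (Λ := Λ) hZ hX hA hY hT (le_of_eq hΛ.symm) ?_
  linarith

/-! ### The word estimate -/

/-- **Coercivity of `𝓛_Γ^T` on the word `D_θ^iD_z^jf`** (`i + j ≥ 1`): there are `Λ ≥ 1` and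
`C ≥ 0` (depending on `i, j` only) such that for all `0 < α ≤ 1/200` and all smooth test functions `f`
(compact support inside the open strip, `L₁₂(f)(0) = 0`), with `u = D_θ^iD_z^jf`,
`sqW_η(D_zu) + Λ(sqW_η(u) + sqW_1(u) + sqW_γ(D_θu)) ≤ blockΛ α Λ (D_θ^iD_z^j𝓛_Γ^Tf) u +
C·(LOW_{i+j}(f) + HEAVY_{i,j}(f))` — the inductive step of the `𝓗ᵏ` coercivity with its two error
terms (lower-order words, and the `θ`-heavier word of the same order). [cite: Elgindi2021, §6.3 proof of Proposition 6.13 (p. 18 of arXiv:1904.04795); ElgindiGhoulMasmoudi2021, §3.1 proof of Proposition 3.2 (p. 10 of arXiv:1910.14071)] -/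
theorem wordCoercivity (i j : ℕ) (hij : 1 ≤ i + j) : ∃ Λ : ℝ, 1 ≤ Λ ∧ ∃ C : ℝ, 0 ≤ C ∧
    ∀ α : ℝ, 0 < α → α ≤ 1 / 200 → ∀ f : ℝ → ℝ → ℝ, (∀ n : ℕ, ContDiff ℝ n (uncurry f)) →
    HasCompactSupport (uncurry f) → tsupport (uncurry f) ⊆ strip → L12 f 0 = 0 →
      sqW wEta (Dz (word i j f)) + Λ * (sqW wEta (word i j f) + sqW (fun _ => 1) (word i j f)
        + sqW (wGam α) (Dθ (word i j f))) ≤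
      blockΛ α Λ (Dθ^[i] (Dz^[j] (opLΓT α f))) (word i j f) + C * (lowSum α (i + j) f + heavySum α i j f) := by
  -- (0) the constants, depending on `i, j` only
  obtain ⟨K₁, hK₁0, hK₁⟩ := exists_abs_iterate_Dz₁_const_div_le 2 (j + 2)
  obtain ⟨K₂, hK₂0, hK₂⟩ := exists_abs_iterate_Dz₁_const_div_le 3 (j + 2)
  obtain ⟨CS1, hCS10, hCS1⟩ := exists_integral_sq_iterate_Dz₁_nlRad₁_le j
  obtain ⟨CS1', hCS1'0, hCS1'⟩ := exists_integral_sq_iterate_Dz₁_nlRad₁_le (j + 1)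
  obtain ⟨CS2, hCS20, hCS2⟩ := exists_integral_sq_iterate_Dz₁_nlRad₂_le j
  obtain ⟨CS2', hCS2'0, hCS2'⟩ := exists_integral_sq_iterate_Dz₁_nlRad₂_le (j + 1)
  obtain ⟨CGη, hCGη0, hCGη⟩ := integral_sq_iterate_Dθ₁_angularWeight_rpow_eta_le i
  obtain ⟨CG1, hCG10, hCG1⟩ := integral_sq_iterate_Dθ₁_angularWeight_le i
  obtain ⟨CGγ, hCGγ0, hCGγ⟩ := integral_sq_iterate_Dθ₁_angularWeight_rpow_gamma_le i
  obtain ⟨Bj, hBj0, hBjdef⟩ : ∃ Bj : ℝ, 0 ≤ Bj ∧ Bj = ∑ l ∈ range j, (j.choose (l + 1) : ℝ) :=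
    ⟨_, Finset.sum_nonneg fun l _ => Nat.cast_nonneg _, rfl⟩
  -- grouped cross coefficients
  obtain ⟨aT, haT0, haTdef⟩ : ∃ aT : ℝ, 0 ≤ aT ∧ aT = 10 * Bj * (2 * K₁ + 2 * K₂)
      + 10 * Real.sqrt (CS1' * (j + 2) * CGη) + 10 * Real.sqrt (CS2' * CGη) := ⟨_, by positivity, rfl⟩
  obtain ⟨aY, haY0, haYdef⟩ : ∃ aY : ℝ, 0 ≤ aY ∧ aY = 10 * Bj * K₂ := ⟨_, by positivity, rfl⟩
  obtain ⟨bX, hbX0, hbXdef⟩ : ∃ bX : ℝ, 0 ≤ bX ∧ bX = 10 ^ 10 * (Bj * (K₁ + K₂)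
      + Real.sqrt (CS1 * (j + 1) * CGη) + Real.sqrt (CS2 * CGη)) := ⟨_, by positivity, rfl⟩
  obtain ⟨bA, hbA0, hbAdef⟩ : ∃ bA : ℝ, 0 ≤ bA ∧ bA = 10 ^ 17 * (Bj * (K₁ + K₂)
      + Real.sqrt (CS1 * (j + 1) * CG1) + Real.sqrt (CS2 * CG1)) := ⟨_, by positivity, rfl⟩
  obtain ⟨bY, hbY0, hbYdef⟩ : ∃ bY : ℝ, 0 ≤ bY ∧ bY = 10 ^ 21 * (Bj * (K₁ + K₂)
      + Real.sqrt (CS1 * (j + 1) * CGγ) + Real.sqrt (CS2 * CGγ)) := ⟨_, by positivity, rfl⟩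
  obtain ⟨a, ha0, hadef⟩ : ∃ a : ℝ, 0 ≤ a ∧ a = aT + aY := ⟨_, by positivity, rfl⟩
  obtain ⟨b, hb0, hbdef⟩ : ∃ b : ℝ, 0 ≤ b ∧ b = bX + bA + bY := ⟨_, by positivity, rfl⟩
  refine ⟨1 + a ^ 2 + b ^ 2, by nlinarith [sq_nonneg a, sq_nonneg b], a ^ 2 + (1 + a ^ 2 + b ^ 2) * b ^ 2,
    by positivity, ?_⟩
  intro α hα hα' f hf hs hsub hL0
  obtain ⟨Λ, hΛ0, hΛdef⟩ : ∃ Λ : ℝ, 0 ≤ Λ ∧ Λ = 1 + a ^ 2 + b ^ 2 := ⟨_, by positivity, rfl⟩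
  have hΛ1 : 1 ≤ Λ := by rw [hΛdef]; nlinarith [sq_nonneg a, sq_nonneg b]
  rw [← hΛdef]
  have hα1 : α ≤ 1 := hα'.trans (by norm_num)
  have hαI : α ∈ Icc (0 : ℝ) 1 := ⟨hα.le, hα1⟩
  -- (1) the word `u` and its relatives are test functions
  obtain ⟨hu3, hus, husub⟩ := word_test hf hs hsub i j 3
  have hu1 : ContDiff ℝ 1 (uncurry (word i j f)) := hu3.of_le (by norm_num)
  obtain ⟨T, hT0, hTdef⟩ : ∃ T : ℝ, 0 ≤ T ∧ T = lowSum α (i + j) f + heavySum α i j f :=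
    ⟨_, add_nonneg (lowSum_nonneg _ _ _) (heavySum_nonneg _ _ _ _), rfl⟩
  rw [← hTdef]
  have hZ0 : 0 ≤ sqW wEta (Dz (word i j f)) := sqW_nonneg isWeight_wEta _
  have hX0 : 0 ≤ sqW wEta (word i j f) := sqW_nonneg isWeight_wEta _
  have hA0 : 0 ≤ sqW (fun _ => (1 : ℝ)) (word i j f) := sqW_nonneg isWeight_one _
  have hY0 : 0 ≤ sqW (wGam α) (Dθ (word i j f)) := sqW_nonneg (isWeight_wGam α) _
  have sZ := Real.sqrt_nonneg (sqW wEta (Dz (word i j f)))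
  have sX := Real.sqrt_nonneg (sqW wEta (word i j f))
  have sA := Real.sqrt_nonneg (sqW (fun _ => (1 : ℝ)) (word i j f))
  have sY := Real.sqrt_nonneg (sqW (wGam α) (Dθ (word i j f)))
  -- (2) split the block; (3) the local part
  have hsplit := blockΛ_word_split hf hs hsub hα.le Λ i j
  have hloc := localBlockΛ hα.le hα1 hΛ1 hu3 hus husub
  -- (4) the commutator pieces
  have hlow : ∀ {i' j' : ℕ}, i' + j' < i + j →
      sqW wEta (Dz (word i' j' f)) ≤ T ∧ sqW wEta (word i' j' f) ≤ T ∧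
      sqW (fun _ => 1) (word i' j' f) ≤ T ∧ sqW (wGam α) (Dθ (word i' j' f)) ≤ T := by
    intro i' j' h
    rw [hTdef]
    exact components_le_T h i j f
  have hP1 : ∀ l ∈ range j, |blockΛ α Λ (radialMul (Dz₁^[l + 1] (fun z : ℝ => 2 / (1 + z))) (word i (j - (l + 1)) f)) (word i j f)|
      ≤ 10 * (K₁ * Real.sqrt T + K₁ * Real.sqrt T) * Real.sqrt (sqW wEta (Dz (word i j f)))
        + Λ * (10 ^ 10 * K₁ * Real.sqrt T * Real.sqrt (sqW wEta (word i j f))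
          + 10 ^ 17 * K₁ * Real.sqrt T * Real.sqrt (sqW (fun _ => 1) (word i j f))
          + 10 ^ 21 * K₁ * Real.sqrt T * Real.sqrt (sqW (wGam α) (Dθ (word i j f)))) := by
    intro l hl
    have hl' : l < j := mem_range.1 hl
    obtain ⟨hg2, hgs, hgsub⟩ := word_test hf hs hsub i (j - (l + 1)) 2
    have hm : ContDiffOn ℝ 1 (Dz₁^[l + 1] (fun z : ℝ => 2 / (1 + z))) (Ioi 0) :=
      contDiffOn_iterate_Dz₁_Ioi (N := l + 2) (contDiffOn_const_div_one_add 2 _) (by omega)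
    have hM : ∀ z ∈ Ioi (0 : ℝ), |Dz₁^[l + 1] (fun z : ℝ => 2 / (1 + z)) z| ≤ K₁ := fun z hz =>
      hK₁ (l + 1) (by omega) z (le_of_lt hz)
    have hM' : ∀ z ∈ Ioi (0 : ℝ), |Dz₁ (Dz₁^[l + 1] (fun z : ℝ => 2 / (1 + z))) z| ≤ K₁ := fun z hz => by
      rw [← Function.iterate_succ_apply' Dz₁ (l + 1)]
      exact hK₁ (l + 2) (by omega) z (le_of_lt hz)
    have h := abs_blockΛ_radialMul_le (α := α) hΛ0 hK₁0 hK₁0 hm hM hM' hg2 hgs hgsub hu1 hus husub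
    obtain ⟨c1, c2, c3, c4⟩ := hlow (i' := i) (j' := j - (l + 1)) (by omega)
    exact bound_mono_radial hK₁0 hΛ0 sZ sX sA sY (Real.sqrt_le_sqrt c2) (Real.sqrt_le_sqrt c1)
      (Real.sqrt_le_sqrt c2) (Real.sqrt_le_sqrt c3) (Real.sqrt_le_sqrt c4) h
  have hP2 : ∀ l ∈ range j, |blockΛ α Λ (radialMul (Dz₁^[l + 1] (fun z : ℝ => 3 / (1 + z))) (word (i + 1) (j - (l + 1)) f)) (word i j f)|
      ≤ 10 * (K₂ * Real.sqrt T + K₂ * (Real.sqrt T + Real.sqrt (sqW (wGam α) (Dθ (word i j f))))) *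
          Real.sqrt (sqW wEta (Dz (word i j f)))
        + Λ * (10 ^ 10 * K₂ * Real.sqrt T * Real.sqrt (sqW wEta (word i j f))
          + 10 ^ 17 * K₂ * Real.sqrt T * Real.sqrt (sqW (fun _ => 1) (word i j f))
          + 10 ^ 21 * K₂ * Real.sqrt T * Real.sqrt (sqW (wGam α) (Dθ (word i j f)))) := by
    intro l hl
    have hl' : l < j := mem_range.1 hl
    obtain ⟨hg2, hgs, hgsub⟩ := word_test hf hs hsub (i + 1) (j - (l + 1)) 2
    have hm : ContDiffOn ℝ 1 (Dz₁^[l + 1] (fun z : ℝ => 3 / (1 + z))) (Ioi 0) :=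
      contDiffOn_iterate_Dz₁_Ioi (N := l + 2) (contDiffOn_const_div_one_add 3 _) (by omega)
    have hM : ∀ z ∈ Ioi (0 : ℝ), |Dz₁^[l + 1] (fun z : ℝ => 3 / (1 + z)) z| ≤ K₂ := fun z hz =>
      hK₂ (l + 1) (by omega) z (le_of_lt hz)
    have hM' : ∀ z ∈ Ioi (0 : ℝ), |Dz₁ (Dz₁^[l + 1] (fun z : ℝ => 3 / (1 + z))) z| ≤ K₂ := fun z hz => by
      rw [← Function.iterate_succ_apply' Dz₁ (l + 1)]
      exact hK₂ (l + 2) (by omega) z (le_of_lt hz)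
    have h := abs_blockΛ_radialMul_le (α := α) hΛ0 hK₂0 hK₂0 hm hM hM' hg2 hgs hgsub hu1 hus husub
    -- components of `g' = D_θ^{i+1} D_z^{j-l-1} f`
    have cX : sqW wEta (word (i + 1) (j - (l + 1)) f) ≤ T ∧ sqW (fun _ => 1) (word (i + 1) (j - (l + 1)) f) ≤ T ∧
        sqW (wGam α) (Dθ (word (i + 1) (j - (l + 1)) f)) ≤ T := by
      rcases Nat.eq_zero_or_pos l with rfl | hlpos
      · have e : j - (0 + 1) = j - 1 := by omega
        rw [e, hTdef]
        exact heavy_components_le_T α i j (by omega) f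
      · obtain ⟨-, c2, c3, c4⟩ := hlow (i' := i + 1) (j' := j - (l + 1)) (by omega)
        exact ⟨c2, c3, c4⟩
    have cZ : sqW wEta (Dz (word (i + 1) (j - (l + 1)) f)) ≤ T + sqW (wGam α) (Dθ (word i j f)) := by
      rcases Nat.eq_zero_or_pos l with rfl | hlpos
      · have e : ∀ p ∈ strip, Dz (word (i + 1) (j - (0 + 1)) f) p.1 p.2 = Dθ (word i j f) p.1 p.2 := by
          intro p hp
          rw [Dz_word hf (i + 1) (j - (0 + 1)) p hp, Dθ_word]
          have e' : j - (0 + 1) + 1 = j := by omega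
          rw [e']
        rw [sqW_congr e]
        obtain ⟨hθc, hθs, hθsub⟩ := test_Dθ hu1 hus husub
        have hle := sqW_wEta_le_wGam hα.le hθc hθs hθsub
        linarith
      · obtain ⟨c1, -, -, -⟩ := hlow (i' := i + 1) (j' := j - (l + 1)) (by omega)
        linarith
    obtain ⟨c2, c3, c4⟩ := cX
    have s1 : Real.sqrt (sqW wEta (Dz (word (i + 1) (j - (l + 1)) f))) ≤ Real.sqrt T + Real.sqrt (sqW (wGam α) (Dθ (word i j f))) :=
      (Real.sqrt_le_sqrt cZ).trans (sqrt_add_le' hT0 hY0)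
    exact bound_mono_radial hK₂0 hΛ0 sZ sX sA sY (Real.sqrt_le_sqrt c2) s1
      (Real.sqrt_le_sqrt c2) (Real.sqrt_le_sqrt c3) (Real.sqrt_le_sqrt c4) h
  have hCom : |∑ l ∈ range j, (j.choose (l + 1) : ℝ) *
        (blockΛ α Λ (radialMul (Dz₁^[l + 1] (fun z : ℝ => 2 / (1 + z))) (word i (j - (l + 1)) f)) (word i j f)
          + blockΛ α Λ (radialMul (Dz₁^[l + 1] (fun z : ℝ => 3 / (1 + z))) (word (i + 1) (j - (l + 1)) f)) (word i j f))|
      ≤ Bj * ((10 * (K₁ * Real.sqrt T + K₁ * Real.sqrt T) * Real.sqrt (sqW wEta (Dz (word i j f)))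
          + Λ * (10 ^ 10 * K₁ * Real.sqrt T * Real.sqrt (sqW wEta (word i j f))
            + 10 ^ 17 * K₁ * Real.sqrt T * Real.sqrt (sqW (fun _ => 1) (word i j f))
            + 10 ^ 21 * K₁ * Real.sqrt T * Real.sqrt (sqW (wGam α) (Dθ (word i j f)))))
        + (10 * (K₂ * Real.sqrt T + K₂ * (Real.sqrt T + Real.sqrt (sqW (wGam α) (Dθ (word i j f))))) *
            Real.sqrt (sqW wEta (Dz (word i j f)))
          + Λ * (10 ^ 10 * K₂ * Real.sqrt T * Real.sqrt (sqW wEta (word i j f))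
            + 10 ^ 17 * K₂ * Real.sqrt T * Real.sqrt (sqW (fun _ => 1) (word i j f))
            + 10 ^ 21 * K₂ * Real.sqrt T * Real.sqrt (sqW (wGam α) (Dθ (word i j f)))))) := by
    refine (Finset.abs_sum_le_sum_abs _ _).trans ?_
    rw [hBjdef, Finset.sum_mul]
    refine Finset.sum_le_sum fun l hl => ?_
    rw [abs_mul, Nat.abs_cast]
    exact mul_le_mul_of_nonneg_left ((abs_add_le _ _).trans (add_le_add (hP1 l hl) (hP2 l hl))) (Nat.cast_nonneg _)
  -- (5) the non-local pieces
  have hA1 : ∀ b' ≤ j, sqW (fun _ => 1) (word 0 b' f) ≤ T := by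
    intro b' hb'
    rcases Nat.lt_or_ge b' j with hlt | hge
    · exact (hlow (i' := 0) (j' := b') (by omega)).2.2.1
    · have hbj : b' = j := le_antisymm hb' hge
      subst hbj
      rcases Nat.eq_zero_or_pos i with hi0 | hipos
      · subst hi0
        obtain ⟨huc', hus', husub'⟩ := word_test hf hs hsub 0 b' 1
        have h1 : sqW (fun _ => 1) (word 0 b' f) ≤ sqW wEta (word 0 b' f) := sqW_one_le_wEta huc'.continuous hus' husub'
        have e : ∀ p ∈ strip, Dz (word 0 (b' - 1) f) p.1 p.2 = word 0 b' f p.1 p.2 := by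
          intro p hp
          rw [Dz_word hf 0 (b' - 1) p hp]
          have e' : b' - 1 + 1 = b' := by omega
          rw [e']
        have h2 : sqW wEta (word 0 b' f) = sqW wEta (Dz (word 0 (b' - 1) f)) := (sqW_congr e).symm
        have h3 := (hlow (i' := 0) (j' := b' - 1) (by omega)).1
        linarith
      · exact (hlow (i' := 0) (j' := b') (by omega)).2.2.1
  have hAsum : ∀ m ≤ j + 1, (∫ p in strip, (f p.1 p.2 * radialWeight p.1) ^ 2) +
      ∑ b' ∈ range m, ∫ p in strip, (Dz^[b'] f p.1 p.2 * radialWeight p.1) ^ 2 ≤ (m + 1) * T := by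
    intro m hm
    have h0 : (∫ p in strip, (f p.1 p.2 * radialWeight p.1) ^ 2) ≤ T := by
      have := hA1 0 (Nat.zero_le _)
      rwa [sqW_one_eq] at this
    have hrest : ∑ b' ∈ range m, ∫ p in strip, (Dz^[b'] f p.1 p.2 * radialWeight p.1) ^ 2 ≤ ∑ b' ∈ range m, T := by
      refine Finset.sum_le_sum fun b' hb' => ?_
      have := hA1 b' (by have := mem_range.1 hb'; omega)
      rwa [sqW_one_eq] at this
    rw [Finset.sum_const, Finset.card_range, nsmul_eq_mul] at hrest
    linarith
  obtain ⟨iS1, bS1⟩ := hCS1 α hα.le hα' f (j + 2) (hf (j + 2)) hs hsub hL0 le_rfl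
  obtain ⟨iS1', bS1'⟩ := hCS1' α hα.le hα' f (j + 3) (hf (j + 3)) hs hsub hL0 le_rfl
  obtain ⟨iS2, bS2⟩ := hCS2 α hα.le hα' f (hf 2) hs hsub
  obtain ⟨iS2', bS2'⟩ := hCS2' α hα.le hα' f (hf 2) hs hsub
  obtain ⟨iGη, bGη⟩ := hCGη α hαI
  obtain ⟨iG1, bG1⟩ := hCG1 α hαI
  obtain ⟨iGγ, bGγ⟩ := hCGγ α ⟨hα, hα1⟩
  have hS1c : ContDiffOn ℝ 1 (Dz₁^[j] (nlRad₁ α f)) (Ioi 0) :=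
    contDiffOn_iterate_Dz₁_Ioi (N := j + 1) (contDiffOn_nlRad₁ α (hf (j + 1)) hs hsub) le_rfl
  have hS2c : ContDiffOn ℝ 1 (Dz₁^[j] (nlRad₂ α f)) (Ioi 0) :=
    contDiffOn_iterate_Dz₁_Ioi (N := j + 1) (contDiffOn_nlRad₂ α f _) le_rfl
  have hGc : ContDiffOn ℝ 1 (Dθ₁^[i] (angularWeight α)) (Ioo 0 (π / 2)) :=
    contDiffOn_iterate_Dθ₁_Ioo (N := i + 1) (contDiffOn_angularWeight α _) le_rfl
  have eS1 : (fun z => Dz₁ (Dz₁^[j] (nlRad₁ α f)) z ^ 2 * radialWeight z ^ 2) =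
      fun z => Dz₁^[j + 1] (nlRad₁ α f) z ^ 2 * radialWeight z ^ 2 := by
    funext z; rw [← Function.iterate_succ_apply' Dz₁ j]
  have eS2 : (fun z => Dz₁ (Dz₁^[j] (nlRad₂ α f)) z ^ 2 * radialWeight z ^ 2) =
      fun z => Dz₁^[j + 1] (nlRad₂ α f) z ^ 2 * radialWeight z ^ 2 := by
    funext z; rw [← Function.iterate_succ_apply' Dz₁ j]
  have eGγ : (fun θ => Dθ₁ (Dθ₁^[i] (angularWeight α)) θ ^ 2 * wGam α θ) =
      fun θ => Dθ₁^[i + 1] (angularWeight α) θ ^ 2 * Real.sin (2 * θ) ^ (-gammaExp α) := by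
    funext θ; rw [← Function.iterate_succ_apply' Dθ₁ i]; rfl
  have iG1' : IntegrableOn (fun θ => Dθ₁^[i] (angularWeight α) θ ^ 2 * (1 : ℝ)) (Ioo 0 (π / 2)) :=
    iG1.congr_fun (fun θ _ => by ring) measurableSet_Ioo
  have hN1 := abs_blockΛ_tensor_le (α := α) hΛ0 hS1c hGc iS1 (by rw [eS1]; exact iS1') iGη iG1' (by rw [eGγ]; exact iGγ)
    hu1 hus husub
  have hN2 := abs_blockΛ_tensor_le (α := α) hΛ0 hS2c hGc iS2 (by rw [eS2]; exact iS2') iGη iG1' (by rw [eGγ]; exact iGγ)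
    hu1 hus husub
  rw [eS1, eGγ] at hN1
  rw [eS2, eGγ] at hN2
  -- the one-dimensional integrals
  have hj : ((j : ℕ) : ℝ) + 1 + 1 = (j : ℝ) + 2 := by ring
  have bI1 : ∫ z in Ioi 0, Dz₁^[j + 1] (nlRad₁ α f) z ^ 2 * radialWeight z ^ 2 ≤ CS1' * ((j : ℝ) + 2) * T := by
    have h := hAsum (j + 1) le_rfl
    push_cast at h
    rw [hj] at h
    calc _ ≤ CS1' * ((∫ p in strip, (f p.1 p.2 * radialWeight p.1) ^ 2) +
        ∑ b' ∈ range (j + 1), ∫ p in strip, (Dz^[b'] f p.1 p.2 * radialWeight p.1) ^ 2) := bS1'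
      _ ≤ CS1' * (((j : ℝ) + 2) * T) := mul_le_mul_of_nonneg_left h hCS1'0
      _ = CS1' * ((j : ℝ) + 2) * T := by ring
  have bI0 : ∫ z in Ioi 0, Dz₁^[j] (nlRad₁ α f) z ^ 2 * radialWeight z ^ 2 ≤ CS1 * ((j : ℝ) + 1) * T := by
    have h := hAsum j (Nat.le_succ j)
    calc _ ≤ CS1 * ((∫ p in strip, (f p.1 p.2 * radialWeight p.1) ^ 2) +
        ∑ b' ∈ range j, ∫ p in strip, (Dz^[b'] f p.1 p.2 * radialWeight p.1) ^ 2) := bS1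
      _ ≤ CS1 * (((j : ℝ) + 1) * T) := mul_le_mul_of_nonneg_left h hCS10
      _ = CS1 * ((j : ℝ) + 1) * T := by ring
  have hAf : (∫ p in strip, (f p.1 p.2 * radialWeight p.1) ^ 2) ≤ T := by
    have := hA1 0 (Nat.zero_le _)
    rwa [sqW_one_eq] at this
  have bJ1 : ∫ z in Ioi 0, Dz₁^[j + 1] (nlRad₂ α f) z ^ 2 * radialWeight z ^ 2 ≤ CS2' * T :=
    bS2'.trans (mul_le_mul_of_nonneg_left hAf hCS2'0)
  have bJ0 : ∫ z in Ioi 0, Dz₁^[j] (nlRad₂ α f) z ^ 2 * radialWeight z ^ 2 ≤ CS2 * T :=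
    bS2.trans (mul_le_mul_of_nonneg_left hAf hCS20)
  have bGη' : ∫ θ in Ioo 0 (π / 2), Dθ₁^[i] (angularWeight α) θ ^ 2 * wEta θ ≤ CGη := bGη
  have bG1' : ∫ θ in Ioo 0 (π / 2), Dθ₁^[i] (angularWeight α) θ ^ 2 * (1 : ℝ) ≤ CG1 := by simpa using bG1
  have bGγ' : ∫ θ in Ioo 0 (π / 2), Dθ₁^[i + 1] (angularWeight α) θ ^ 2 * Real.sin (2 * θ) ^ (-gammaExp α) ≤ CGγ := by
    refine bGγ.trans ?_
    calc CGγ * α ≤ CGγ * 1 := mul_le_mul_of_nonneg_left hα1 hCGγ0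
      _ = CGγ := mul_one _
  have hGη0 : 0 ≤ ∫ θ in Ioo 0 (π / 2), Dθ₁^[i] (angularWeight α) θ ^ 2 * wEta θ :=
    setIntegral_nonneg measurableSet_Ioo fun θ hθ => mul_nonneg (sq_nonneg _) (isWeight_wEta.nonneg θ hθ)
  have hG10 : 0 ≤ ∫ θ in Ioo 0 (π / 2), Dθ₁^[i] (angularWeight α) θ ^ 2 * (1 : ℝ) :=
    setIntegral_nonneg measurableSet_Ioo fun θ _ => mul_nonneg (sq_nonneg _) zero_le_one
  have hGγ0 : 0 ≤ ∫ θ in Ioo 0 (π / 2), Dθ₁^[i + 1] (angularWeight α) θ ^ 2 * Real.sin (2 * θ) ^ (-gammaExp α) :=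
    setIntegral_nonneg measurableSet_Ioo fun θ hθ => mul_nonneg (sq_nonneg _) ((isWeight_wGam α).nonneg θ hθ)
  have hj2 : (0 : ℝ) ≤ CS1' * ((j : ℝ) + 2) := by positivity
  have hj1 : (0 : ℝ) ≤ CS1 * ((j : ℝ) + 1) := by positivity
  have hN1' := bound_mono_tensor hΛ0 sZ sX sA sY
    (sqrt_prod_le bI1 bGη' hGη0 hj2 hT0 hCGη0) (sqrt_prod_le bI0 bGη' hGη0 hj1 hT0 hCGη0)
    (sqrt_prod_le bI0 bG1' hG10 hj1 hT0 hCG10) (sqrt_prod_le bI0 bGγ' hGγ0 hj1 hT0 hCGγ0) hN1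
  have hN2' := bound_mono_tensor hΛ0 sZ sX sA sY
    (sqrt_prod_le bJ1 bGη' hGη0 hCS2'0 hT0 hCGη0) (sqrt_prod_le bJ0 bGη' hGη0 hCS20 hT0 hCGη0)
    (sqrt_prod_le bJ0 bG1' hG10 hCS20 hT0 hCG10) (sqrt_prod_le bJ0 bGγ' hGγ0 hCS20 hT0 hCGγ0) hN2
  -- (6) assembly
  have habsC := abs_le.1 hCom
  have habs1 := abs_le.1 hN1'
  have habs2 := abs_le.1 hN2'
  have haT : aT ≤ a := by rw [hadef]; linarith
  have haY : aY ≤ a := by rw [hadef]; linarith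
  have hbX : bX ≤ b := by rw [hbdef]; linarith
  have hbA : bA ≤ b := by rw [hbdef]; linarith
  have hbY : bY ≤ b := by rw [hbdef]; linarith
  refine word_assembly' (aT := aT) (aY := aY) (bX := bX) (bA := bA) (bY := bY) (T := T) ha0 hZ0 hX0 hA0 hY0 hT0
    haT haY hbX hbA hbY hΛdef ?_
  rw [hsplit]
  have ecross : (aT * Real.sqrt T + aY * Real.sqrt (sqW (wGam α) (Dθ (word i j f)))) * Real.sqrt (sqW wEta (Dz (word i j f)))
      + Λ * Real.sqrt T * (bX * Real.sqrt (sqW wEta (word i j f)) + bA * Real.sqrt (sqW (fun _ => 1) (word i j f))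
        + bY * Real.sqrt (sqW (wGam α) (Dθ (word i j f)))) =
      Bj * ((10 * (K₁ * Real.sqrt T + K₁ * Real.sqrt T) * Real.sqrt (sqW wEta (Dz (word i j f)))
          + Λ * (10 ^ 10 * K₁ * Real.sqrt T * Real.sqrt (sqW wEta (word i j f))
            + 10 ^ 17 * K₁ * Real.sqrt T * Real.sqrt (sqW (fun _ => 1) (word i j f))
            + 10 ^ 21 * K₁ * Real.sqrt T * Real.sqrt (sqW (wGam α) (Dθ (word i j f)))))
        + (10 * (K₂ * Real.sqrt T + K₂ * (Real.sqrt T + Real.sqrt (sqW (wGam α) (Dθ (word i j f))))) *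
            Real.sqrt (sqW wEta (Dz (word i j f)))
          + Λ * (10 ^ 10 * K₂ * Real.sqrt T * Real.sqrt (sqW wEta (word i j f))
            + 10 ^ 17 * K₂ * Real.sqrt T * Real.sqrt (sqW (fun _ => 1) (word i j f))
            + 10 ^ 21 * K₂ * Real.sqrt T * Real.sqrt (sqW (wGam α) (Dθ (word i j f))))))
      + (10 * (Real.sqrt (CS1' * ((j : ℝ) + 2) * CGη) * Real.sqrt T) * Real.sqrt (sqW wEta (Dz (word i j f)))
          + Λ * (10 ^ 10 * (Real.sqrt (CS1 * ((j : ℝ) + 1) * CGη) * Real.sqrt T) * Real.sqrt (sqW wEta (word i j f))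
            + 10 ^ 17 * (Real.sqrt (CS1 * ((j : ℝ) + 1) * CG1) * Real.sqrt T) * Real.sqrt (sqW (fun _ => 1) (word i j f))
            + 10 ^ 21 * (Real.sqrt (CS1 * ((j : ℝ) + 1) * CGγ) * Real.sqrt T) * Real.sqrt (sqW (wGam α) (Dθ (word i j f)))))
      + (10 * (Real.sqrt (CS2' * CGη) * Real.sqrt T) * Real.sqrt (sqW wEta (Dz (word i j f)))
          + Λ * (10 ^ 10 * (Real.sqrt (CS2 * CGη) * Real.sqrt T) * Real.sqrt (sqW wEta (word i j f))
            + 10 ^ 17 * (Real.sqrt (CS2 * CG1) * Real.sqrt T) * Real.sqrt (sqW (fun _ => 1) (word i j f))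
            + 10 ^ 21 * (Real.sqrt (CS2 * CGγ) * Real.sqrt T) * Real.sqrt (sqW (wGam α) (Dθ (word i j f))))) := by
    rw [haTdef, haYdef, hbXdef, hbAdef, hbYdef]
    ring
  rw [ecross]
  linarith [hloc, habsC.1, habsC.2, habs1.1, habs1.2, habs2.1, habs2.2]

end Elgindi

end Literature.Analysis.FluidPDE
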